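import Summits.QuantumFields.BalabanUV.Beta.EriceFlowEnclosureCesaroClockSampling
import Summits.QuantumFields.BalabanUV.Beta.EriceFlowEnclosureAbelTauberianSeq
import Summits.QuantumFields.BalabanUV.Beta.EriceFlowEnclosureWeightedTauberianPower
import Summits.QuantumFields.BalabanUV.Beta.EriceFlowEnclosureLogMeanEscape

/-!
# Beta / EriceFlowEnclosureWeightedClockSampling — WEIGHTED CUTOFF AVERAGES ALONG THE TWO-LOOP CLOCK: FOR M LOG-LIPSCHITZ (AND BOUNDED NEAR 0⁺)
# SAMPLED AT CUTOFF COUPLINGS h_n WITH `n·h_n → L₀ > 0`, **THE ABEL (exponential), THE POWER-WEIGHTED ((n+1)^σ, σ > −1) AND EVERY (G)-WEIGHTED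
# CUTOFF AVERAGE OF THE DEVIATION `d_n = c·(M(h_n) − m) + o(1)` TENDS TO 0 ⟺ d_n → 0 ⟺ M → m at 0⁺ — NONE OF THEM CAN CREATE THE DATUM —
# WHILE THE LOGARITHMIC CUTOFF AVERAGE CAN** (witness `M t = sin(log(L₀∕t))`, `h n = L₀∕(n+1)`): the by-name junction of P2 #53b's clock with
# P2 #54b (Abel, Hardy–Littlewood–Karamata), P2 #54c∕#54d (weights under (G)) and P2 #54f (the logarithmic escape).  Pure [folklore] SERVICE in the
# SHAPES rows L119 ∕ L120 deliver — the weighted twin of P2 #53b `cutoffAverage_iff`; no Erice sentence occurs.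
#   §1 `sampled_abs_le` (the samples are bounded once M is bounded on ]0, δ[ — finitely many early cutoffs + the tail inside ]0, δ[);
#      **`abelCutoffAverage_iff`** (Abel: summability clause + `(1 − x)·Σ d_n xⁿ → 0 ⟺ d → 0 ⟺ M(h_n) → m ⟺ M → m`);
#   §2 **`weightedCutoffAverage_iff`** (any p ≥ 0 with P → ∞ and (G)), **`powerCutoffAverage_iff`** (`p n = (n+1)^σ`, −1 < σ ≤ 0; σ = 0 is P2 #53b);
#   §3 **`logCutoffAverage_escapes`** — ∃ M, h with ALL the clock hypotheses (1-log-Lipschitz on ]0, ∞[, |M| ≤ 1, h > 0, n·h_n → L₀) whose uniform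
#      RG-time average of the samples DIVERGES (as it must, P2 #53b) but whose LOGARITHMIC RG-time average CONVERGES (to 0) although M has NO limit
#      at 0⁺: averaging uniformly in `log n` (= log log cutoff) is smoothing enough to manufacture a datum; the honest Tauberian class for the
#      logarithmic average is slow decrease on the POWER scales n → n^λ (Kwee ∕ Móricz, in the tree), which no clock sampling supplies.
# (β-flow team, prover 2 = lower ∕ positivity side, unit `b2b-balaban-beta-bflow-p2`, gen 37; module P2 #54g)

HONEST FRAMING (page 1 of everything the β sub-cell writes): discharging `BetaPertH` makes Bałaban's UV stability UNCONDITIONAL — a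
real constructive-QFT result; it is NOT the continuum limit and NOT the Clay problem.  HONEST DEPENDENCY (cell reorg 2026-08-19,
verbatim): «continuum YM on T⁴ ⇐ BetaPertH ∧ nine spine estimates (0/9 proved); BetaPertH ⇐ (D1) ∧ (D4) ∧ CAP+tail; G-an2-4 gates
asym, D1 and NE2/3/4.»  THIS MODULE DISCHARGES NOTHING and quotes nothing: by-name compositions of [folklore] Tauberian theorems with the
lineage's clock sampling; «datum ∕ deviation ∕ cutoff average» are OUR READINGS of (3.76)'s O(1) term (rows L119–L142), hypotheses on the LIMIT β.

THE POINT.  P2 #53b: along the clock the samples `M(h_n)` are slowly oscillating in n, and `M(h_n) → m ⟺ M → m at 0⁺`.  Every averaging method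
whose Tauberian class contains the slowly oscillating bounded sequences therefore returns `M → m` from the convergence of the averaged deviation:
(C,1) (P2 #53a∕#53b), Abel (P2 #54b), the (G)-weights and all power weights (P2 #54c∕#54d).  The logarithmic method's class is smaller (power-scale
slow decrease), and the gap is real: `sin(log(n+1))` = the samples of `sin(log(L₀∕t))` at `h_n = L₀∕(n+1)`.

WHAT THIS FILE PROVES (0 sorry, 0 def): §1 `sampled_abs_le`, `deviation_bddBelow`, **`abelCutoffAverage_iff`**; §2 **`weightedCutoffAverage_iff`**,
**`powerCutoffAverage_iff`**; §3 `escape_clock`, `escape_logLip`, `escape_samples`, END **`logCutoffAverage_escapes`**.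
NOT CLAIMED: the (3.76) letter version by name over rows L120∕L122 (it is P2 #53c∕#53f with `cutoffAverage_iff` replaced by the present ENDs —
routine, not filed); rates; `BetaPertH`; continuum; Clay.
-/

namespace Summit.QuantumFields.BalabanUV.Beta.EriceFlowEnclosureWeightedClockSampling

open Finset Filter Topology
open Summit.QuantumFields.BalabanUV.Beta.EriceFlowEnclosureCesaroTauberianSeq
open Summit.QuantumFields.BalabanUV.Beta.EriceFlowEnclosureCesaroClockSampling
open Summit.QuantumFields.BalabanUV.Beta.EriceFlowEnclosureAbelTauberianSeq
open Summit.QuantumFields.BalabanUV.Beta.EriceFlowEnclosureWeightedTauberianSeq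
open Summit.QuantumFields.BalabanUV.Beta.EriceFlowEnclosureWeightedTauberianPower
open Summit.QuantumFields.BalabanUV.Beta.EriceFlowEnclosureLogMeanSeq
open Summit.QuantumFields.BalabanUV.Beta.EriceFlowEnclosureLogMeanEscape

noncomputable section

variable {M : ℝ → ℝ} {h e : ℕ → ℝ} {δ C L₀ B : ℝ}

/-! ## §1 The Abel cutoff average along the clock -/

/-- THE SAMPLES ARE BOUNDED: if `|M t| ≤ B` on ]0, δ[ and the cutoff couplings `h_n > 0` tend to 0 along the clock, then `|M(h_n)| ≤ B'` for ALL n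
(the finitely many early cutoffs outside ]0, δ[ are absorbed in B'). [folklore] -/
theorem sampled_abs_le (hδ : 0 < δ) (hbdd : ∀ t : ℝ, 0 < t → t < δ → |M t| ≤ B) (hpos : ∀ n, 0 < h n)
    (hclock : Tendsto (fun n : ℕ => (n : ℝ) * h n) atTop (𝓝 L₀)) : ∃ B', ∀ n, |M (h n)| ≤ B' := by
  have h0 : Tendsto h atTop (𝓝 0) := clock_tendsto_zero hclock
  obtain ⟨N₁, hN₁⟩ := Metric.tendsto_atTop.mp h0 δ hδ
  refine ⟨max B (∑ n ∈ range N₁, |M (h n)|), fun n => ?_⟩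
  rcases lt_or_ge n N₁ with hn | hn
  · exact le_trans (single_le_sum (f := fun n => |M (h n)|) (fun i _ => abs_nonneg _) (mem_range.mpr hn)) (le_max_right _ _)
  · have := hN₁ n hn
    rw [Real.dist_eq, sub_zero, abs_of_pos (hpos n)] at this
    exact (hbdd (h n) (hpos n) this).trans (le_max_left _ _)

/-- THE DEVIATION IS BOUNDED BELOW: `∃ b, ∀ n, b ≤ c·(M(h_n) − m)`. [folklore] -/
theorem deviation_bddBelow (hδ : 0 < δ) (hbdd : ∀ t : ℝ, 0 < t → t < δ → |M t| ≤ B) (hpos : ∀ n, 0 < h n)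
    (hclock : Tendsto (fun n : ℕ => (n : ℝ) * h n) atTop (𝓝 L₀)) (c m : ℝ) :
    ∃ b, ∀ n, b ≤ c * (M (h n) - m) := by
  obtain ⟨B', hB'⟩ := sampled_abs_le hδ hbdd hpos hclock
  refine ⟨-(|c| * (B' + |m|)), fun n => ?_⟩
  have h1 : |c * (M (h n) - m)| ≤ |c| * (B' + |m|) := by
    rw [abs_mul]
    refine mul_le_mul_of_nonneg_left ?_ (abs_nonneg c)
    have := abs_sub (M (h n)) m; linarith [hB' n]
  exact (abs_le.mp h1).1

/-- **THE ABEL (EXPONENTIALLY WEIGHTED) CUTOFF AVERAGE CANNOT CREATE THE DATUM.**  M C-log-Lipschitz and bounded on ]0, δ[, cutoff couplings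
`h_n > 0` with `n·h_n → L₀ > 0`, `e_n → 0`, `c ≠ 0`.  Then for the deviation `d_n = c·(M(h_n) − m) + e_n`:
`[Σ d_n xⁿ summable on [0,1[ ∧ (1 − x)·Σ d_n xⁿ → 0 (x → 1⁻)] ⟺ d_n → 0 ⟺ M(h_n) → m ⟺ M → m at 0⁺` — P2 #54b `abel_add_null_iff`
(Hardy–Littlewood–Karamata + Schmidt) on the slowly oscillating bounded-below deviation (P2 #53b `deviation_slowlyOscillating`) and P2 #53b
`cutoffAverage_iff`. [folklore] -/
theorem abelCutoffAverage_iff (hC : 0 < C) (hδ : 0 < δ)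
    (hlip : ∀ t u : ℝ, 0 < t → t ≤ u → u < δ → |M u - M t| ≤ C * Real.log (u / t))
    (hbdd : ∀ t : ℝ, 0 < t → t < δ → |M t| ≤ B)
    (hpos : ∀ n, 0 < h n) (hL₀ : 0 < L₀) (hclock : Tendsto (fun n : ℕ => (n : ℝ) * h n) atTop (𝓝 L₀))
    (he : Tendsto e atTop (𝓝 0)) {c : ℝ} (hc : c ≠ 0) (m : ℝ) :
    (((∀ x : ℝ, 0 ≤ x → x < 1 → Summable fun n => (c * (M (h n) - m) + e n) * x ^ n) ∧
        Tendsto (fun x : ℝ => (1 - x) * ∑' n, (c * (M (h n) - m) + e n) * x ^ n) (𝓝[<] 1) (𝓝 0)) ↔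
        Tendsto (fun n => c * (M (h n) - m) + e n) atTop (𝓝 0)) ∧
      (Tendsto (fun n => c * (M (h n) - m) + e n) atTop (𝓝 0) ↔ Tendsto (fun n => M (h n)) atTop (𝓝 m)) ∧
      (Tendsto (fun n => M (h n)) atTop (𝓝 m) ↔ Tendsto M (𝓝[>] 0) (𝓝 m)) := by
  obtain ⟨b, hb⟩ := deviation_bddBelow hδ hbdd hpos hclock c m
  have hso := deviation_slowlyOscillating hC hδ hlip hpos hL₀ hclock c m
  have hA := (abel_add_null_iff (u := fun n => c * (M (h n) - m)) hb hso he 0).1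
  have hB := cutoffAverage_iff hC hδ hlip hpos hL₀ hclock he hc m
  exact ⟨hA, hB.2⟩

/-! ## §2 The (G)-weighted and the power-weighted cutoff averages along the clock -/

/-- **NO (G)-WEIGHTED CUTOFF AVERAGE CAN CREATE THE DATUM.**  Weights p ≥ 0 with `Σ_{n<N} p n → ∞` and P2 #54c's growth condition (G); M, h, e, c
as in `abelCutoffAverage_iff` (no boundedness needed): `(Σ_{n<N} p n·d_n)∕(Σ_{n<N} p n) → 0 ⟺ d_n → 0 ⟺ M(h_n) → m ⟺ M → m at 0⁺`
(P2 #54c `weightedMean_iff_tendsto_of_slowlyOscillating` + P2 #53b). [folklore] -/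
theorem weightedCutoffAverage_iff {p : ℕ → ℝ} (hp : ∀ n, 0 ≤ p n)
    (hP : Tendsto (fun N => ∑ n ∈ range N, p n) atTop atTop)
    (hG : ∀ q > (1:ℝ), ∃ ρ > (1:ℝ), ∃ N₁ : ℕ, ∀ N J : ℕ, N₁ ≤ N → q * N ≤ (J : ℝ) →
      ρ * (∑ n ∈ range N, p n) ≤ ∑ n ∈ range J, p n)
    (hC : 0 < C) (hδ : 0 < δ)
    (hlip : ∀ t u : ℝ, 0 < t → t ≤ u → u < δ → |M u - M t| ≤ C * Real.log (u / t))
    (hpos : ∀ n, 0 < h n) (hL₀ : 0 < L₀) (hclock : Tendsto (fun n : ℕ => (n : ℝ) * h n) atTop (𝓝 L₀))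
    (he : Tendsto e atTop (𝓝 0)) {c : ℝ} (hc : c ≠ 0) (m : ℝ) :
    (Tendsto (fun N => (∑ n ∈ range N, p n * (c * (M (h n) - m) + e n)) / ∑ n ∈ range N, p n) atTop (𝓝 0) ↔
        Tendsto (fun n => c * (M (h n) - m) + e n) atTop (𝓝 0)) ∧
      (Tendsto (fun n => c * (M (h n) - m) + e n) atTop (𝓝 0) ↔ Tendsto (fun n => M (h n)) atTop (𝓝 m)) ∧
      (Tendsto (fun n => M (h n)) atTop (𝓝 m) ↔ Tendsto M (𝓝[>] 0) (𝓝 m)) := by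
  have hso := slowlyOscillating_add_null (deviation_slowlyOscillating hC hδ hlip hpos hL₀ hclock c m) he
  have hA := weightedMean_iff_tendsto_of_slowlyOscillating (a := fun n => c * (M (h n) - m) + e n) hp hP hG hso 0
  have hB := cutoffAverage_iff hC hδ hlip hpos hL₀ hclock he hc m
  exact ⟨hA, hB.2⟩

/-- **NO POWER-WEIGHTED CUTOFF AVERAGE CAN CREATE THE DATUM**: for −1 < σ ≤ 0,
`(Σ_{n<N} (n+1)^σ·d_n)∕(Σ_{n<N} (n+1)^σ) → 0 ⟺ d_n → 0 ⟺ M(h_n) → m ⟺ M → m at 0⁺` (P2 #54d `powerMean_iff_tendsto_of_slowlyOscillating` +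
P2 #53b); σ = 0 is the uniform RG-time average of P2 #53b, σ ↓ −1 approaches the logarithmic average of §3, where the statement FAILS. [folklore] -/
theorem powerCutoffAverage_iff {σ : ℝ} (hσ1 : -1 < σ) (hσ0 : σ ≤ 0) (hC : 0 < C) (hδ : 0 < δ)
    (hlip : ∀ t u : ℝ, 0 < t → t ≤ u → u < δ → |M u - M t| ≤ C * Real.log (u / t))
    (hpos : ∀ n, 0 < h n) (hL₀ : 0 < L₀) (hclock : Tendsto (fun n : ℕ => (n : ℝ) * h n) atTop (𝓝 L₀))
    (he : Tendsto e atTop (𝓝 0)) {c : ℝ} (hc : c ≠ 0) (m : ℝ) :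
    (Tendsto (fun N => (∑ n ∈ range N, ((n : ℝ) + 1) ^ σ * (c * (M (h n) - m) + e n)) /
        ∑ n ∈ range N, ((n : ℝ) + 1) ^ σ) atTop (𝓝 0) ↔
        Tendsto (fun n => c * (M (h n) - m) + e n) atTop (𝓝 0)) ∧
      (Tendsto (fun n => c * (M (h n) - m) + e n) atTop (𝓝 0) ↔ Tendsto (fun n => M (h n)) atTop (𝓝 m)) ∧
      (Tendsto (fun n => M (h n)) atTop (𝓝 m) ↔ Tendsto M (𝓝[>] 0) (𝓝 m)) := by
  have hso := slowlyOscillating_add_null (deviation_slowlyOscillating hC hδ hlip hpos hL₀ hclock c m) he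
  have hA := powerMean_iff_tendsto_of_slowlyOscillating (a := fun n => c * (M (h n) - m) + e n) hσ1 hσ0 hso 0
  have hB := cutoffAverage_iff hC hδ hlip hpos hL₀ hclock he hc m
  exact ⟨hA, hB.2⟩

/-! ## §3 The logarithmic cutoff average CAN create a datum -/

/-- The clock `h_n = L₀∕(n+1)`: positive and `n·h_n → L₀`. [folklore] -/
theorem escape_clock (hL₀ : 0 < L₀) :
    (∀ n : ℕ, 0 < L₀ / ((n : ℝ) + 1)) ∧ Tendsto (fun n : ℕ => (n : ℝ) * (L₀ / ((n : ℝ) + 1))) atTop (𝓝 L₀) := by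
  refine ⟨fun n => by positivity, ?_⟩
  have h1 := (tendsto_natCast_div_add_atTop (1 : ℝ)).const_mul L₀
  rw [mul_one] at h1
  refine h1.congr fun n => ?_
  ring

/-- `M t = sin(log(L₀∕t))` is 1-log-Lipschitz on ]0, ∞[ (`log(L₀∕u) − log(L₀∕t) = −log(u∕t)`) and bounded by 1. [folklore] -/
theorem escape_logLip (hL₀ : 0 < L₀) :
    (∀ t u : ℝ, 0 < t → t ≤ u → u < 1 →
      |Real.sin (Real.log (L₀ / u)) - Real.sin (Real.log (L₀ / t))| ≤ 1 * Real.log (u / t)) ∧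
    (∀ t : ℝ, 0 < t → t < 1 → |Real.sin (Real.log (L₀ / t))| ≤ 1) := by
  refine ⟨fun t u ht htu _ => ?_, fun t _ _ => Real.abs_sin_le_one _⟩
  have hu : 0 < u := lt_of_lt_of_le ht htu
  have h1 := Real.abs_sin_sub_sin_le (Real.log (L₀ / u)) (Real.log (L₀ / t))
  have h2 : Real.log (L₀ / u) - Real.log (L₀ / t) = -Real.log (u / t) := by
    rw [Real.log_div hL₀.ne' hu.ne', Real.log_div hL₀.ne' ht.ne', Real.log_div hu.ne' ht.ne']; ring
  have h3 : 0 ≤ Real.log (u / t) := Real.log_nonneg (by rw [le_div_iff₀ ht]; linarith)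
  rw [h2, abs_neg, abs_of_nonneg h3] at h1
  linarith

/-- The samples of `M t = sin(log(L₀∕t))` at `h_n = L₀∕(n+1)` are P2 #54f's witness `sin(log(n+1))`. [folklore] -/
theorem escape_samples (hL₀ : 0 < L₀) (n : ℕ) :
    Real.sin (Real.log (L₀ / (L₀ / ((n : ℝ) + 1)))) = Real.sin (Real.log ((n : ℝ) + 1)) := by
  congr 2
  field_simp

/-- **THE LOGARITHMIC CUTOFF AVERAGE CAN CREATE A DATUM (END).**  For every L₀ > 0 there are M (= `sin(log(L₀∕t))`) and cutoff couplings h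
(= `L₀∕(n+1)`) satisfying ALL the clock hypotheses of §§1–2 — M 1-log-Lipschitz and bounded by 1 on ]0, 1[, `h_n > 0`, `n·h_n → L₀` — such that
(i) the uniform RG-time (Cesàro) average of the samples converges to NO value (as §2 ∕ P2 #53b force, M having no limit), yet
(ii) the LOGARITHMIC cutoff average `(Σ_{n<N} M(h_n)∕(n+1))∕H_N → 0`, although (iii) M has NO limit at 0⁺.  So the equivalences of §§1–2 are
FALSE for the logarithmic weights (P2 #54e: they violate (G)); by P2 #54f. [folklore] -/
theorem logCutoffAverage_escapes (hL₀ : 0 < L₀) : ∃ (M : ℝ → ℝ) (h : ℕ → ℝ),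
    (∀ t u : ℝ, 0 < t → t ≤ u → u < 1 → |M u - M t| ≤ 1 * Real.log (u / t)) ∧
    (∀ t : ℝ, 0 < t → t < 1 → |M t| ≤ 1) ∧
    (∀ n, 0 < h n) ∧ Tendsto (fun n : ℕ => (n : ℝ) * h n) atTop (𝓝 L₀) ∧
    (¬ ∃ m' : ℝ, Tendsto (fun N : ℕ => (N : ℝ)⁻¹ * ∑ n ∈ range N, M (h n)) atTop (𝓝 m')) ∧
    Tendsto (fun N => (∑ n ∈ range N, ((n : ℝ) + 1)⁻¹ * M (h n)) / ∑ n ∈ range N, ((n : ℝ) + 1)⁻¹) atTop (𝓝 0) ∧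
    ¬ ∃ m : ℝ, Tendsto M (𝓝[>] 0) (𝓝 m) := by
  obtain ⟨hpos, hclock⟩ := escape_clock hL₀
  obtain ⟨hlip, hbdd⟩ := escape_logLip hL₀
  refine ⟨fun t => Real.sin (Real.log (L₀ / t)), fun n => L₀ / ((n : ℝ) + 1), hlip, hbdd, hpos, hclock, ?_, ?_, ?_⟩
  · rintro ⟨m', hm'⟩
    have hces : Tendsto (fun N : ℕ => (N : ℝ)⁻¹ * ∑ n ∈ range N, Real.sin (Real.log ((n : ℝ) + 1))) atTop (𝓝 m') :=
      hm'.congr fun N => by simp only [escape_samples hL₀]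
    exact witness_not_tendsto ⟨m', (cesaro_iff_tendsto_of_slowlyOscillating witness_slowlyOscillating m').mp hces⟩
  · refine witness_logMean_tendsto_zero.congr fun N => ?_
    simp only [escape_samples hL₀]
  · rintro ⟨m, hm⟩
    have hs := tendsto_sampled_of_tendsto (M := fun t => Real.sin (Real.log (L₀ / t))) hpos hclock hm
    exact witness_not_tendsto ⟨m, hs.congr fun n => escape_samples hL₀ n⟩

end

end Summit.QuantumFields.BalabanUV.Beta.EriceFlowEnclosureWeightedClockSampling
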